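import Mathlib
import Summits.Ventures.PercRepro.TriangleCapFourBelowAssembly
import Summits.Ventures.PercRepro.TriangleCapFourBelowOneTriangle

/-!
# PercRepro — FOUR BELOW THE DIAGONAL: THE ASSEMBLY FOR `k ≥ 13` MODULO THE ONE-TRIANGLE GRAPHS WITH FEW OUTER
VERTICES (p3, gen 39; part 126)

**`dense_stability_four_modulo_few_outer`**: `K₄⁻`-free, `k ≥ 13`, `2m ≥ 6k − 26`, no product `a′ (k − a′)` among
`m, …, m + 3` ⇒ `Σ_v d(v)² + 4 (k − 5) ≤ m k`, modulo the one-triangle graphs (every degree `≥ 2`) with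
`10q + 2m + 28 < 8k` outer vertices and either `q ≤ 4` or `m ≥ 3k` — the outer count
(`one_triangle_stability_four_of_outer'`) and the private-set count with five outer vertices
(`one_triangle_stability_four_of_five_outer`) discharge the rest of the one-triangle case of
`dense_stability_four_modulo_one_triangle`.  On the cells `m = a (k − a) − 4`: for `a = 3` what is left is
`q ≤ 4`; for `a ≥ 4` (`m ≥ 4k − 20`) it is `q ≤ 1`.  Axioms: standard.
-/

namespace PercRepro

namespace TriangleCap

namespace C047

open Finset

variable {V : Type*} [Fintype V] [DecidableEq V]

/-- **THE `r = 4` STABILITY FOR `k ≥ 13` MODULO THE ONE-TRIANGLE GRAPHS WITH FEW OUTER VERTICES.** -/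
theorem dense_stability_four_modulo_few_outer (D : SimpleGraph V) [DecidableRel D.Adj] (hK : K4mFree D)
    (hk : 13 ≤ Fintype.card V) (hm : 6 * Fintype.card V ≤ 2 * D.edgeFinset.card + 26)
    (hprod : ∀ a', a' ≤ Fintype.card V → D.edgeFinset.card ≠ a' * (Fintype.card V - a') ∧
      D.edgeFinset.card + 1 ≠ a' * (Fintype.card V - a') ∧ D.edgeFinset.card + 2 ≠ a' * (Fintype.card V - a') ∧
      D.edgeFinset.card + 3 ≠ a' * (Fintype.card V - a'))
    (hone : ∀ u v w, D.Adj u v → D.Adj u w → D.Adj v w →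
      (∀ a b c, D.Adj a b → D.Adj a c → D.Adj b c → a = u ∨ a = v ∨ a = w) → (∀ z, 2 ≤ deg D z) →
      10 * ((({u, v, w} : Finset V)ᶜ).filter (fun z => degIn D {u, v, w} z = 0)).card + 2 * D.edgeFinset.card + 28 <
        8 * Fintype.card V →
      (((({u, v, w} : Finset V)ᶜ).filter (fun z => degIn D {u, v, w} z = 0)).card ≤ 4 ∨
        3 * Fintype.card V ≤ D.edgeFinset.card) →
      ∑ v, deg D v * deg D v + 4 * (Fintype.card V - 5) ≤ D.edgeFinset.card * Fintype.card V) :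
    ∑ v, deg D v * deg D v + 4 * (Fintype.card V - 5) ≤ D.edgeFinset.card * Fintype.card V := by
  apply dense_stability_four_modulo_one_triangle D hK hk hm hprod
  intro u v w huv huw hvw hT hdeg
  by_cases hpay : 8 * Fintype.card V ≤
      10 * ((({u, v, w} : Finset V)ᶜ).filter (fun z => degIn D {u, v, w} z = 0)).card + 2 * D.edgeFinset.card + 28
  · exact one_triangle_stability_four_of_outer' D hK huv huw hvw hT (by omega) hdeg hpay
  push Not at hpay
  by_cases hq : ((({u, v, w} : Finset V)ᶜ).filter (fun z => degIn D {u, v, w} z = 0)).card ≤ 4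
  · exact hone u v w huv huw hvw hT hdeg hpay (Or.inl hq)
  push Not at hq
  by_cases hm3 : D.edgeFinset.card + 1 ≤ 3 * Fintype.card V
  · exact one_triangle_stability_four_of_five_outer D hK huv huw hvw hT (by omega) hdeg (by omega) hm3
  · exact hone u v w huv huw hvw hT hdeg hpay (Or.inr (by omega))

end C047

end TriangleCap

end PercRepro
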